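import Literature.Combinatorics.SimpleGraph.ReducedDivisors
import HarnessLib

/-!
# `(v₁) ∼ (v₂)` iff `v₁` and `v₂` are joined by a path of bridges (Baker–Norine 2007, Lemma 4.6)

Source (held, read at the page; statements VERBATIM). M. Baker, S. Norine, *Riemann–Roch and
Abel–Jacobi theory on a finite graph*, Adv. Math. 215 (2007) 766–788 [BakerNorine2007] (held
text `paper:doi-10-1016-j-aim-2007-04-012`, chunks p0019–p0020), §4.4: «The circuit theory
argument actually tells us something more precise about the failure of `S` to be injective on a
general graph `G`. Let `G̃` be the graph obtained by contracting every edge of `G` which is not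
part of a cycle, and let `ρ : G → G̃` be the natural map. **Lemma 4.6.** `ρ(v₁) = ρ(v₂)` if and
only if `(v₁) ∼ (v₂)`. *Proof.* `ρ(v₁) = ρ(v₂)` if and only if there is a path from `v₁` to `v₂`
in `G`, none of whose edges belong to a cycle. By circuit theory, this occurs if and only if there
is a unit current flow from `v₁` to `v₂` which is integral along each edge. By the above
discussion, this happens if and only if `(v₁) ∼ (v₂)`.» (§4.3: «Recall that a graph `G` is
2-edge-connected if and only if every edge of `G` is contained in a cycle.»)

## What is formalised (vocabulary: `LinEquiv G` of `GraphDivisors`, `charFun` of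
## `ReducedDivisors`; an edge belonging to no cycle is Mathlib's `G.IsBridge`, cf.
## `SimpleGraph.isBridge_iff_forall_cycle_notMem`)

Lemma 4.6 in the form «`(v₁) ∼ (v₂)` iff there is a path from `v₁` to `v₂` none of whose edges
belong to a cycle», with a potential-theoretic proof replacing the circuit theory:
* `lapMatrix_mulVec_charFun_of_unique_edge` — if `ab` is the only edge leaving `A`, firing all
  of `A` moves one dollar from `a` to `b` (`Δχ_A = (a) − (b)`); hence
  **`linEquiv_single_of_isBridge`** (`(u) ∼ (w)` across a bridge `uw`) and
  `linEquiv_single_of_walk_isBridge` (the «if» direction);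
* **`exists_walk_isBridge_of_lapMatrix_mulVec_eq`** — the «only if» direction: if
  `Δf = (v₁) − (v₂)` with `v₁ ≠ v₂`, the maximum set `M` of `f` has exactly one boundary edge
  `v₁b`, which is a bridge with `f(b) = max f − 1`; replacing `f` by `f − χ_M` gives
  `Δ(f − χ_M) = (b) − (v₂)` with a smaller range, and induction produces the path of bridges;
* **`linEquiv_single_iff_exists_walk_isBridge`** (Lemma 4.6) and its cycle wording
  `linEquiv_single_iff_exists_walk_forall_cycle`.

Theorems only; no `sorry`; no named facts.
-/

open Finset SimpleGraph Matrix
open Literature.Combinatorics.SimpleGraph.ChipFiring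

namespace Literature.Combinatorics.SimpleGraph.BakerNorine

variable {V : Type*} [Fintype V] [DecidableEq V] {G : SimpleGraph V} [DecidableRel G.Adj]

/-! ### §1 Firing one side of a single-edge cut -/

section Cut

/-- If `ab` (`a ∈ A`, `b ∉ A`) is the only edge between `A` and its complement, then firing every
vertex of `A` once moves exactly one dollar, from `a` to `b`: `Δ χ_A = (a) − (b)`.
[cite: BakerNorine2007, §4.3–§4.4 (proof of Lemma 4.6)] -/
theorem lapMatrix_mulVec_charFun_of_unique_edge {A : Finset V} {a b : V} (ha : a ∈ A)
    (hb : b ∉ A) (hab : G.Adj a b) (huniq : ∀ x ∈ A, ∀ y ∉ A, G.Adj x y → x = a ∧ y = b) :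
    G.lapMatrix ℤ *ᵥ charFun A = Pi.single a 1 - Pi.single b 1 := by
  funext v
  rw [lapMatrix_mulVec_charFun_apply, Pi.sub_apply, Pi.single_apply, Pi.single_apply]
  have hsplit := Finset.card_sdiff_add_card_inter (G.neighborFinset v) A
  rw [card_neighborFinset_eq_degree] at hsplit
  by_cases hv : v ∈ A
  · rw [if_pos hv, if_neg (fun h : v = b => hb (h ▸ hv))]
    by_cases hva : v = a
    · subst hva
      have h1 : G.neighborFinset v \ A = {b} := by
        refine Finset.eq_singleton_iff_unique_mem.2 ⟨mem_sdiff.2 ⟨(mem_neighborFinset G v b).2 hab,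
          hb⟩, fun y hy => ?_⟩
        obtain ⟨hy1, hy2⟩ := mem_sdiff.1 hy
        exact (huniq v hv y hy2 ((mem_neighborFinset G v y).1 hy1)).2
      rw [h1, card_singleton] at hsplit
      rw [if_pos rfl]
      omega
    · have h0 : #(G.neighborFinset v \ A) = 0 := by
        refine Finset.card_eq_zero.2 (Finset.eq_empty_iff_forall_notMem.2 fun y hy => ?_)
        obtain ⟨hy1, hy2⟩ := mem_sdiff.1 hy
        exact hva (huniq v hv y hy2 ((mem_neighborFinset G v y).1 hy1)).1
      rw [h0] at hsplit
      rw [if_neg hva]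
      omega
  · rw [if_neg hv, if_neg (fun h : v = a => hv (h ▸ ha))]
    by_cases hvb : v = b
    · subst hvb
      have h1 : G.neighborFinset v ∩ A = {a} := by
        refine Finset.eq_singleton_iff_unique_mem.2
          ⟨mem_inter.2 ⟨(mem_neighborFinset G v a).2 hab.symm, ha⟩, fun y hy => ?_⟩
        obtain ⟨hy1, hy2⟩ := mem_inter.1 hy
        exact (huniq y hy2 v hv ((mem_neighborFinset G v y).1 hy1).symm).1
      rw [h1, card_singleton, if_pos rfl]
      ring
    · have h0 : #(G.neighborFinset v ∩ A) = 0 := by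
        refine Finset.card_eq_zero.2 (Finset.eq_empty_iff_forall_notMem.2 fun y hy => ?_)
        obtain ⟨hy1, hy2⟩ := mem_inter.1 hy
        exact hvb (huniq y hy2 v hv ((mem_neighborFinset G v y).1 hy1).symm).2
      rw [h0, if_neg hvb]
      simp

/-- **A bridge moves a dollar**: if `uw` is a bridge then `(u) ∼ (w)` — fire every vertex of the
component of `u` in `G − uw`. [cite: BakerNorine2007, Lemma 4.6 (proof)] -/
theorem linEquiv_single_of_isBridge {u w : V} (huw : G.Adj u w) (hbr : G.IsBridge s(u, w)) :
    LinEquiv G (Pi.single u 1) (Pi.single w 1) := by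
  classical
  -- `U`: the vertices reachable from `u` avoiding the edge `uw`
  set U : Finset V := univ.filter fun x => (G.deleteEdges {s(u, w)}).Reachable u x with hU
  have hmemU : ∀ x, x ∈ U ↔ (G.deleteEdges {s(u, w)}).Reachable u x := fun x => by
    rw [hU, mem_filter]; exact ⟨fun h => h.2, fun h => ⟨mem_univ _, h⟩⟩
  have huU : u ∈ U := (hmemU u).2 (Reachable.refl u)
  have hwU : w ∉ U := fun h => (isBridge_iff.1 hbr) ((hmemU w).1 h)
  have huniq : ∀ x ∈ U, ∀ y ∉ U, G.Adj x y → x = u ∧ y = w := by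
    intro x hx y hy hxy
    by_contra hne
    apply hy
    refine (hmemU y).2 (((hmemU x).1 hx).trans (Adj.reachable ?_))
    rw [deleteEdges_adj]
    refine ⟨hxy, ?_⟩
    rw [Set.mem_singleton_iff, Sym2.eq_iff]
    rintro (⟨rfl, rfl⟩ | ⟨rfl, rfl⟩)
    · exact hne ⟨rfl, rfl⟩
    · exact hy huU
  have key := lapMatrix_mulVec_charFun_of_unique_edge huU hwU huw huniq
  have h := linEquiv_sub_mulVec G (Pi.single u 1) (charFun U)
  rwa [key, sub_sub_cancel] at h

/-- The «if» direction of Lemma 4.6: a path from `v₁` to `v₂` «none of whose edges belong to a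
cycle» (all of whose edges are bridges) gives `(v₁) ∼ (v₂)`. [cite: BakerNorine2007, Lemma 4.6] -/
theorem linEquiv_single_of_walk_isBridge {v₁ v₂ : V} (p : G.Walk v₁ v₂)
    (hp : ∀ e ∈ p.edges, G.IsBridge e) : LinEquiv G (Pi.single v₁ 1) (Pi.single v₂ 1) := by
  induction p with
  | nil => exact LinEquiv.refl G _
  | cons h p ih =>
    rw [Walk.edges_cons] at hp
    exact (linEquiv_single_of_isBridge h (hp _ List.mem_cons_self)).trans
      (ih fun e he => hp e (List.mem_cons_of_mem _ he))

end Cut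

/-! ### §2 The «only if» direction: level sets of the potential -/

section LevelSets

/-- **The «only if» direction of Lemma 4.6**, by induction on the range of the potential: if
`Δf = (v₁) − (v₂)` (so that `(v₁) ∼ (v₂)`), then `v₁` and `v₂` are joined by a walk all of
whose edges are bridges. (For `v₁ ≠ v₂` the maximum set `M` of `f` has a unique boundary edge,
namely `v₁ b` with `f(b) = max f − 1`; it is a bridge, and `Δ(f − χ_M) = (b) − (v₂)`.)
[cite: BakerNorine2007, Lemma 4.6 (proof, «unit current flow […] integral along each edge»)] -/
theorem exists_walk_isBridge_of_lapMatrix_mulVec_eq (hG : G.Connected) :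
    ∀ (n : ℕ) (f : V → ℤ) (v₁ v₂ : V), (∀ x y, f x - f y ≤ n) →
      G.lapMatrix ℤ *ᵥ f = Pi.single v₁ 1 - Pi.single v₂ 1 →
      ∃ p : G.Walk v₁ v₂, ∀ e ∈ p.edges, G.IsBridge e := by
  classical
  -- if `f` is constant then `Δf = 0`, forcing `v₁ = v₂`
  have hconst : ∀ (f : V → ℤ) (v₁ v₂ : V), (∀ x y, f x = f y) →
      G.lapMatrix ℤ *ᵥ f = Pi.single v₁ 1 - Pi.single v₂ 1 → v₁ = v₂ := by
    intro f v₁ v₂ hc hL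
    by_contra hne
    have h := congrFun hL v₁
    rw [lapMatrix_mulVec_apply_eq_sum_sub, Finset.sum_eq_zero (fun w _ => by rw [hc v₁ w, sub_self]),
      Pi.sub_apply, Pi.single_eq_same, Pi.single_apply, if_neg hne] at h
    omega
  intro n
  induction n with
  | zero =>
    intro f v₁ v₂ hf hL
    have hc : ∀ x y, f x = f y := fun x y => by
      have := hf x y; have := hf y x; omega
    cases hconst f v₁ v₂ hc hL
    exact ⟨Walk.nil, fun e he => by simp at he⟩
  | succ n ih =>
    intro f v₁ v₂ hf hL
    by_cases heq : v₁ = v₂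
    · cases heq
      exact ⟨Walk.nil, fun e he => by simp at he⟩
    -- the maximum `m` of `f` and its level set `M`
    obtain ⟨a₀, -, hmax⟩ := Finset.exists_max_image univ f ⟨v₁, mem_univ _⟩
    set m := f a₀ with hm
    set M : Finset V := univ.filter fun x => f x = m with hM
    have hmemM : ∀ x, x ∈ M ↔ f x = m := fun x => by rw [hM, mem_filter]; simp
    have hle : ∀ x, f x ≤ m := fun x => hmax x (mem_univ x)
    have hlt : ∀ x, x ∉ M → f x ≤ m - 1 := fun x hx => by
      have h1 := hle x; have h2 : f x ≠ m := fun h => hx ((hmemM x).2 h); omega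
    have ha₀M : a₀ ∈ M := (hmemM a₀).2 rfl
    -- `f` is not constant, so some vertex lies outside `M`
    obtain ⟨z, hzM⟩ : ∃ z, z ∉ M := by
      by_contra hall
      push Not at hall
      exact heq (hconst f v₁ v₂ (fun x y => by rw [(hmemM x).1 (hall x), (hmemM y).1 (hall y)]) hL)
    -- the boundary darts of `M`
    set P : Finset (V × V) :=
      univ.filter fun d => d.1 ∈ M ∧ d.2 ∈ (G.neighborFinset d.1).filter (· ∉ M) with hP
    have hmemP : ∀ d : V × V, d ∈ P ↔ d.1 ∈ M ∧ d.2 ∈ (G.neighborFinset d.1).filter (· ∉ M) :=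
      fun d => by rw [hP, mem_filter]; simp only [mem_univ, true_and]
    have hmemP' : ∀ x y, (x, y) ∈ P ↔ x ∈ M ∧ y ∉ M ∧ G.Adj x y := fun x y => by
      rw [hmemP]
      simp only [Finset.mem_filter, mem_neighborFinset]
      tauto
    -- (1) there is a boundary dart (connectivity)
    have hPne : P.Nonempty := by
      obtain ⟨q⟩ := hG.preconnected a₀ z
      obtain ⟨d, -, hd1, hd2⟩ := q.exists_boundary_dart (M : Set V) (mem_coe.2 ha₀M)
        (fun h => hzM (mem_coe.1 h))
      exact ⟨(d.fst, d.snd), (hmemP' _ _).2 ⟨mem_coe.1 hd1, fun h => hd2 (mem_coe.2 h), d.adj⟩⟩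
    -- (2) the flux out of `M`: `Σ_{x ∈ M} Δf(x) = Σ_{boundary darts} (f x − f y) ≥ #P`
    have hflux : ∑ x ∈ M, (G.lapMatrix ℤ *ᵥ f) x = ∑ d ∈ P, (f d.1 - f d.2) := by
      rw [Finset.sum_finset_product P M (fun x => (G.neighborFinset x).filter (· ∉ M)) hmemP]
      refine Finset.sum_congr rfl fun x hx => ?_
      have hz : ∑ y ∈ (G.neighborFinset x).filter (fun y => ¬ y ∉ M), (f x - f y) = 0 :=
        Finset.sum_eq_zero fun y hy => by
          have hyM : y ∈ M := not_not.1 (mem_filter.1 hy).2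
          rw [(hmemM x).1 hx, (hmemM y).1 hyM, sub_self]
      rw [lapMatrix_mulVec_apply_eq_sum_sub,
        ← Finset.sum_filter_add_sum_filter_not (G.neighborFinset x) (· ∉ M), hz, add_zero]
    have hge : (#P : ℤ) ≤ ∑ d ∈ P, (f d.1 - f d.2) := by
      have h := Finset.card_nsmul_le_sum P (fun d => f d.1 - f d.2) 1 fun d hd => by
        obtain ⟨h1, h2, -⟩ := (hmemP' d.1 d.2).1 hd
        have := (hmemM d.1).1 h1; have := hlt d.2 h2
        show (1 : ℤ) ≤ f d.1 - f d.2
        omega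
      rwa [nsmul_eq_mul, mul_one] at h
    -- (3) but `Σ_{x ∈ M} Δf(x) = [v₁ ∈ M] − [v₂ ∈ M] ≤ 1`
    have hval : ∑ x ∈ M, (G.lapMatrix ℤ *ᵥ f) x =
        (if v₁ ∈ M then 1 else 0) - (if v₂ ∈ M then 1 else 0) := by
      rw [hL]
      simp only [Pi.sub_apply, Finset.sum_sub_distrib, Finset.sum_pi_single']
    have hcard : 0 < #P := card_pos.2 hPne
    -- hence `v₁ ∈ M`, `v₂ ∉ M`, and exactly one boundary dart, with potential drop `1`
    have hv₁M : v₁ ∈ M := by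
      by_contra h; rw [hflux.symm.trans hval, if_neg h] at hge; split_ifs at hge <;> omega
    have hv₂M : v₂ ∉ M := by
      intro h; rw [hflux.symm.trans hval, if_pos hv₁M, if_pos h] at hge; omega
    rw [if_pos hv₁M, if_neg hv₂M] at hval
    have hP1 : #P = 1 := by
      have : (#P : ℤ) ≤ 1 := hge.trans (hflux.symm.trans hval).le
      omega
    obtain ⟨⟨a, b⟩, hPab⟩ := Finset.card_eq_one.1 hP1
    have hab : (a, b) ∈ P := by rw [hPab]; exact mem_singleton_self _
    obtain ⟨haM, hbM, hadj⟩ := (hmemP' a b).1 hab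
    have huniq : ∀ x ∈ M, ∀ y ∉ M, G.Adj x y → x = a ∧ y = b := fun x hx y hy hxy => by
      have h := (hmemP' x y).2 ⟨hx, hy, hxy⟩
      rw [hPab, mem_singleton] at h
      obtain ⟨h1, h2⟩ := Prod.ext_iff.1 h
      exact ⟨h1, h2⟩
    have hfb : f b = m - 1 := by
      have h := hflux.symm.trans hval
      rw [hPab, sum_singleton] at h
      have := (hmemM a).1 haM
      simp only at h
      omega
    -- `a = v₁`: the flux out of `a` is at least the drop along `ab`
    have hav : a = v₁ := by
      by_contra hne
      have h := congrFun hL a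
      rw [Pi.sub_apply, Pi.single_apply, Pi.single_apply, if_neg hne,
        if_neg (fun h : a = v₂ => hv₂M (h ▸ haM)), lapMatrix_mulVec_apply_eq_sum_sub] at h
      have h1 : f a - f b ≤ ∑ w ∈ G.neighborFinset a, (f a - f w) :=
        Finset.single_le_sum (f := fun w => f a - f w) (fun w _ => by
          have := hle w; have := (hmemM a).1 haM; show (0 : ℤ) ≤ f a - f w; omega)
          ((mem_neighborFinset G a b).2 hadj)
      have := (hmemM a).1 haM
      omega
    subst hav
    -- `ab` is a bridge: any walk from `a` to `b` avoiding it would leave `M` by another edge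
    have hbridge : G.IsBridge s(a, b) := by
      rw [isBridge_iff]
      rintro ⟨q⟩
      obtain ⟨d, -, hd1, hd2⟩ := q.exists_boundary_dart (M : Set V) (mem_coe.2 haM)
        (fun h => hbM (mem_coe.1 h))
      have hd := d.adj
      rw [deleteEdges_adj, Set.mem_singleton_iff] at hd
      obtain ⟨h1, h2⟩ := huniq d.fst (mem_coe.1 hd1) d.snd (fun h => hd2 (mem_coe.2 h)) hd.1
      exact hd.2 (by rw [h1, h2])
    -- lower the maximum set: `Δ(f − χ_M) = (b) − (v₂)`, with range at most `n`
    have hLM := lapMatrix_mulVec_charFun_of_unique_edge haM hbM hadj huniq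
    have hL' : G.lapMatrix ℤ *ᵥ (f - charFun M) = Pi.single b 1 - Pi.single v₂ 1 := by
      rw [Matrix.mulVec_sub, hL, hLM, sub_sub_sub_cancel_left]
    have hf' : ∀ x y, (f - charFun M) x - (f - charFun M) y ≤ n := by
      intro x y
      simp only [Pi.sub_apply, charFun_apply]
      have hxy := hf x y
      have ha₀y := hf a₀ y
      have hx := hle x
      have hy := hle y
      by_cases hxM : x ∈ M <;> by_cases hyM : y ∈ M
      · rw [if_pos hxM, if_pos hyM, (hmemM x).1 hxM, (hmemM y).1 hyM]; omega
      · rw [if_pos hxM, if_neg hyM, (hmemM x).1 hxM]; omega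
      · rw [if_neg hxM, if_pos hyM, (hmemM y).1 hyM]; have := hlt x hxM; omega
      · rw [if_neg hxM, if_neg hyM]; have := hlt x hxM; omega
    obtain ⟨p, hp⟩ := ih (f - charFun M) b v₂ hf' hL'
    refine ⟨Walk.cons hadj p, fun e he => ?_⟩
    rw [Walk.edges_cons, List.mem_cons] at he
    rcases he with rfl | he
    · exact hbridge
    · exact hp e he

end LevelSets

/-! ### §3 Lemma 4.6 -/

section Main

/-- **Lemma 4.6.** «`ρ(v₁) = ρ(v₂)` if and only if `(v₁) ∼ (v₂)`», where «`ρ(v₁) = ρ(v₂)` if and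
only if there is a path from `v₁` to `v₂` in `G`, none of whose edges belong to a cycle»: for a
connected graph, `(v₁) ∼ (v₂)` iff some walk from `v₁` to `v₂` consists of bridges.
[cite: BakerNorine2007, Lemma 4.6] -/
theorem linEquiv_single_iff_exists_walk_isBridge (hG : G.Connected) (v₁ v₂ : V) :
    LinEquiv G (Pi.single v₁ 1) (Pi.single v₂ 1) ↔
      ∃ p : G.Walk v₁ v₂, ∀ e ∈ p.edges, G.IsBridge e := by
  refine ⟨fun h => ?_, fun ⟨p, hp⟩ => linEquiv_single_of_walk_isBridge p hp⟩
  obtain ⟨f, hf⟩ := (linEquiv_iff_exists_eq_sub G _ _).1 h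
  have hL : G.lapMatrix ℤ *ᵥ f = Pi.single v₁ 1 - Pi.single v₂ 1 := by
    rw [hf, sub_sub_cancel]
  -- a bound on the range of the potential
  obtain ⟨a₁, -, hmax⟩ := Finset.exists_max_image univ f ⟨v₁, mem_univ _⟩
  obtain ⟨a₂, -, hmin⟩ := Finset.exists_min_image univ f ⟨v₁, mem_univ _⟩
  refine exists_walk_isBridge_of_lapMatrix_mulVec_eq hG (f a₁ - f a₂).toNat f v₁ v₂
    (fun x y => ?_) hL
  have h1 := hmax x (mem_univ x)
  have h2 := hmin y (mem_univ y)
  have h3 := Int.self_le_toNat (f a₁ - f a₂)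
  omega

/-- Lemma 4.6 in the source's wording: `(v₁) ∼ (v₂)` iff there is a path from `v₁` to `v₂`
«none of whose edges belong to a cycle». [cite: BakerNorine2007, Lemma 4.6] -/
theorem linEquiv_single_iff_exists_walk_forall_cycle (hG : G.Connected) (v₁ v₂ : V) :
    LinEquiv G (Pi.single v₁ 1) (Pi.single v₂ 1) ↔
      ∃ p : G.Walk v₁ v₂, ∀ e ∈ p.edges,
        ∀ ⦃u : V⦄ (c : G.Walk u u), c.IsCycle → e ∉ c.edges := by
  rw [linEquiv_single_iff_exists_walk_isBridge hG]
  refine exists_congr fun p => forall₂_congr fun e he => ?_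
  exact isBridge_iff_forall_cycle_notMem (p.edges_subset_edgeSet he)

end Main

end Literature.Combinatorics.SimpleGraph.BakerNorine
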